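import Summits.Ventures.Crystal3D.Theorems.StickyWulffConstantCoaxialWallLawSeamCoreSplit
import Summits.Ventures.Crystal3D.Theorems.StickyWulffConstantCoaxialWallLawSeamCapClosure
import HarnessLib

/-!
# THE INCOHERENT-SIDE ASSEMBLY: `IncoherentSeamSmall` from an erosion-lowered coherent certificate, a junk cap bound and seam sparsity
# (crux `CoaxialWallLaw`, stmt-Ventures-19481; line `WallLedgerF`, skeleton 'CoaxialWallLawCertificates' v8.1, stub `stub_incoherentSeamSmall`)

HONEST FRAMING. Venture `Summits/Ventures/Crystal3D` (cell `crystal3d-full`); DEFINITIONS + one composition for the crux `CoaxialWallLaw` (stmt-Ventures-19481,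
`route-Ventures-StickyWulffConstant`), lane F v8.1 (cf-p1 (ccxxix)).  The three inputs are NAMED, not proved; F-C1 not moved.
THE PROOF PLAN OF RECORD for `stub_incoherentSeamSmall : IncoherentSeamSmall (2√6) 3`, as one theorem generic in a CAP FUNCTION `cap D y : ℕ` (healing capacity of
the core ball `y` in the core `D`):
* `coreOf X z S := capClosure (X ∩ B̄(z,3)) (site balls of S)` — the canonical coherent core; `coherentAt_coreOf` — it is coherent as a configuration;
* `CoherentCoreCap cap s₁` (CERTIFICATE, cf-p2 queue-4 lowered objective): every `1`-separated configuration `D`, coherent at a payer `z ∈ D` of degree `≤ 11`,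
  has positive lowered pools `p_D(b) − Σ_{y ∈ D, |y−b| ≤ 1} cap D y` at its loaded balls within `1` of `z` and lowered summand `Σ_b e_D(b)/(p_D(b) − Σ cap) ≤ s₁`;
* `JunkCapBound cap` (ANALYTIC, cap table): a ball of `X` outside the core touches the core ball `y` (within `2` of the payer) only within capacity —
  `#{x ∈ X ∖ D : dist y x = 1} ≤ cap D y` (`…HealCap`: closed lower half-dozen ⇒ `2`; `…HealCapEleven`: eleven slots ⇒ `0`);
* `SeamSparsity p₀ n₀ k₀` (ANALYTIC): at a residual non-coherent payer, deletion on-site or, for some placement, at most `n₀` seam-loaded balls within `1`, each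
  with `p₀ · seamCoreMultA ≤ pooledDef`;
* `localSummandA_le_core_add_seam_at` — `…SeamCoreSplit`'s inequality at a general payer;
* **`incoherentSeamSmall_of_assembly`** — `CoherentCoreCap cap s₁ → JunkCapBound cap → SeamSparsity p₀ n₀ k₀ → 0 < p₀ → s₁ + n₀/p₀ ≤ s → IncoherentSeamSmall s k₀`.
WHAT THIS IS NOT: no input is proved; constants of record (19481-p1 seeds): `s₁ ≈ 3.1` (Σ^low/Σ^count ≤ 3.08), `n₀/p₀ ≈ 1` (parallel-grain family: 8 seam balls at
ratio 8) — `4.1 < 2√6`; F-C1 not moved.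
-/

noncomputable section

namespace Summit.Ventures.Crystal3D.Theorems

namespace TailResidue

open Summit.Ventures.Crystal3D Finset
open scoped InnerProductSpace

section SplitAt

variable {Y E : Finset (EuclideanSpace ℝ (Fin 3))} {v : WordVersion} {S₁ S₂ : PlateSystem}
variable (hY : ∀ p ∈ Y, ∀ q ∈ Y, p ≠ q → 1 ≤ dist p q) (hsub : E ⊆ Y) (h₁ : S₁.RT ⊆ fccSlots) (h₂ : S₂.RT ⊆ fccSlots)

/-! ### The split inequality at a general payer -/

include hY hsub h₁ h₂ in
open scoped Classical in
/-- **THE CORE / SEAM SPLIT at the payer `z`** (verbatim `…SeamCoreSplit.localSummandA_le_core_add_seam` with `0 ↦ z`, positivity asked only at LOADED core balls).  For a core `E ⊆ Y`, `heal(b)` = #(exact within `1` of `b`, non-exact) contacts, `def(b)` = deficiency of the non-exact balls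
within `1` of `b`: if every lowered pool `p_E(b) − heal(b) + def(b)` at an exact ball within `1` of the payer is positive, and every SEAM end ball `b` within
`1` of the payer has `p₀ · seamCoreMultA b ≤ pooledDef Y b` (`p₀ > 0`), then
`Σ_A(Y, z) ≤ Σ_{b ∈ E, |b| ≤ 1} e_E(b) / (p_E(b) − heal(b) + def(b)) + #{b ∈ Y : |b| ≤ 1, seamCoreMultA b > 0} / p₀`. -/
theorem localSummandA_le_core_add_seam_at (z : EuclideanSpace ℝ (Fin 3)) {p₀ : ℝ} (hp₀ : 0 < p₀)
    (hposE : ∀ b ∈ E, dist z b ≤ 1 → 0 < endMultA E v S₁ S₂ b →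
      0 < pooledDef E b - ((((E.filter fun y => dist b y ≤ 1) ×ˢ (Y \ E)).filter fun p => dist p.1 p.2 = 1).card : ℝ) +
        ∑ x ∈ (Y \ E).filter (fun x => dist b x ≤ 1 ∧ (Y.filter fun q => dist x q = 1).card ≤ 11),
          ((12 : ℝ) - ((Y.filter fun q => dist x q = 1).card : ℝ)))
    (hseam : ∀ b ∈ Y, dist z b ≤ 1 → 0 < seamCoreMultA Y E v S₁ S₂ b → p₀ * (seamCoreMultA Y E v S₁ S₂ b : ℝ) ≤ pooledDef Y b) :
    localSummandA v S₁ S₂ Y z ≤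
      (∑ b ∈ E.filter (fun b => dist z b ≤ 1 ∧ 0 < endMultA E v S₁ S₂ b),
        (endMultA E v S₁ S₂ b : ℝ) /
          (pooledDef E b - ((((E.filter fun y => dist b y ≤ 1) ×ˢ (Y \ E)).filter fun p => dist p.1 p.2 = 1).card : ℝ) +
            ∑ x ∈ (Y \ E).filter (fun x => dist b x ≤ 1 ∧ (Y.filter fun q => dist x q = 1).card ≤ 11),
              ((12 : ℝ) - ((Y.filter fun q => dist x q = 1).card : ℝ)))) +
      ((Y.filter fun b => dist z b ≤ 1 ∧ 0 < seamCoreMultA Y E v S₁ S₂ b).card : ℝ) / p₀ := by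
  unfold localSummandA
  have hexle : ∀ b, coreMultA Y E v S₁ S₂ b ≤ endMultA E v S₁ S₂ b := fun b => coreMultA_le hY hsub h₁ h₂ b
  have hpoolle : ∀ b, pooledDef E b +
      ∑ x ∈ (Y \ E).filter (fun x => dist b x ≤ 1 ∧ (Y.filter fun q => dist x q = 1).card ≤ 11), ((12 : ℝ) - ((Y.filter fun q => dist x q = 1).card : ℝ)) ≤
      pooledDef Y b + (((E.filter fun y => dist b y ≤ 1) ×ˢ (Y \ E)).filter fun p => dist p.1 p.2 = 1).card := fun b => pooledDef_core_le hY hsub b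
  set A := Y.filter (fun b => dist z b ≤ 1 ∧ 0 < endMultA Y v S₁ S₂ b) with hA
  set AE := E.filter (fun b => dist z b ≤ 1 ∧ 0 < endMultA E v S₁ S₂ b) with hAE
  set AS := Y.filter (fun b => dist z b ≤ 1 ∧ 0 < seamCoreMultA Y E v S₁ S₂ b) with hAS
  set D : EuclideanSpace ℝ (Fin 3) → ℝ := fun b =>
    pooledDef E b - ((((E.filter fun y => dist b y ≤ 1) ×ˢ (Y \ E)).filter fun p => dist p.1 p.2 = 1).card : ℝ) +
      ∑ x ∈ (Y \ E).filter (fun x => dist b x ≤ 1 ∧ (Y.filter fun q => dist x q = 1).card ≤ 11), ((12 : ℝ) - ((Y.filter fun q => dist x q = 1).card : ℝ))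
    with hD
  set gE : EuclideanSpace ℝ (Fin 3) → ℝ := fun b => (endMultA E v S₁ S₂ b : ℝ) / D b with hgE
  set fX : EuclideanSpace ℝ (Fin 3) → ℝ := fun b => (coreMultA Y E v S₁ S₂ b : ℝ) / pooledDef Y b with hfX
  set fS : EuclideanSpace ℝ (Fin 3) → ℝ := fun b => (seamCoreMultA Y E v S₁ S₂ b : ℝ) / pooledDef Y b with hfS
  -- pools of loaded balls are positive: the payer `0`… we only need positivity where used; get it from the two hypotheses
  -- termwise split of the summand
  have hsplit : ∀ b ∈ A, (endMultA Y v S₁ S₂ b : ℝ) / pooledDef Y b = fX b + fS b := by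
    intro b _
    simp only [hfX, hfS, ← add_div]
    congr 1
    exact_mod_cast (coreMultA_add_seamCoreMultA (Y := Y) (E := E) (v := v) (S₁ := S₁) (S₂ := S₂) b).symm
  rw [sum_congr rfl hsplit, sum_add_distrib]
  -- exact part
  have hexact : ∑ b ∈ A, fX b ≤ ∑ b ∈ AE, gE b := by
    have key : ∀ b ∈ A, (0 < coreMultA Y E v S₁ S₂ b → b ∈ AE ∧ fX b ≤ gE b) ∧ (coreMultA Y E v S₁ S₂ b = 0 → fX b = 0) := by
      intro b hb
      obtain ⟨hbY, hb1, hepos⟩ := mem_filter.1 hb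
      refine ⟨fun hx => ?_, fun h0 => by simp only [hfX, h0, Nat.cast_zero, zero_div]⟩
      -- `b` is exact (it is the end ball of an exact pair)
      obtain ⟨q, hq⟩ : ∃ q, q ∈ Y.filter fun q => IsCorePairA Y E v S₁ S₂ b q := by
        by_contra hne
        push Not at hne
        have : coreMultA Y E v S₁ S₂ b = 0 := by
          unfold coreMultA; rw [card_eq_zero]; exact eq_empty_of_forall_notMem hne
        omega
      obtain ⟨-, -, -, G, d, -, -, -, -, hbE, -⟩ := (mem_filter.1 hq).2
      have hle := hexle b
      have hp := hpoolle b
      have hDpos : 0 < D b := hposE b hbE hb1 (lt_of_lt_of_le hx hle)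
      have hDle : D b ≤ pooledDef Y b := by simp only [hD]; linarith
      refine ⟨mem_filter.2 ⟨hbE, hb1, lt_of_lt_of_le hx hle⟩, ?_⟩
      have hleR : (coreMultA Y E v S₁ S₂ b : ℝ) ≤ (endMultA E v S₁ S₂ b : ℝ) := by exact_mod_cast hle
      calc fX b = (coreMultA Y E v S₁ S₂ b : ℝ) / pooledDef Y b := rfl
        _ ≤ (endMultA E v S₁ S₂ b : ℝ) / pooledDef Y b := div_le_div_of_nonneg_right hleR (hDpos.le.trans hDle)
        _ ≤ gE b := div_le_div_of_nonneg_left (Nat.cast_nonneg _) hDpos hDle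
    have hgnn : ∀ b ∈ AE, 0 ≤ gE b := fun b hb => div_nonneg (Nat.cast_nonneg _) (hposE b (mem_filter.1 hb).1 (mem_filter.1 hb).2.1 (mem_filter.1 hb).2.2).le
    calc ∑ b ∈ A, fX b = ∑ b ∈ A.filter (fun b => 0 < coreMultA Y E v S₁ S₂ b), fX b :=
          (sum_filter_of_ne fun b hb hne => Nat.pos_of_ne_zero fun h0 => hne ((key b hb).2 h0)).symm
      _ ≤ ∑ b ∈ A.filter (fun b => 0 < coreMultA Y E v S₁ S₂ b), gE b :=
          sum_le_sum fun b hb => ((key b (mem_filter.1 hb).1).1 (mem_filter.1 hb).2).2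
      _ ≤ ∑ b ∈ AE, gE b :=
          sum_le_sum_of_subset_of_nonneg (fun b hb => ((key b (mem_filter.1 hb).1).1 (mem_filter.1 hb).2).1) fun b hb _ => hgnn b hb
  -- seam part
  have hseam' : ∑ b ∈ A, fS b ≤ (AS.card : ℝ) / p₀ := by
    have key : ∀ b ∈ A, (0 < seamCoreMultA Y E v S₁ S₂ b → b ∈ AS ∧ fS b ≤ 1 / p₀) ∧ (seamCoreMultA Y E v S₁ S₂ b = 0 → fS b = 0) := by
      intro b hb
      obtain ⟨hbY, hb1, -⟩ := mem_filter.1 hb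
      refine ⟨fun hs => ⟨mem_filter.2 ⟨hbY, hb1, hs⟩, ?_⟩, fun h0 => by simp only [hfS, h0, Nat.cast_zero, zero_div]⟩
      have hle := hseam b hbY hb1 hs
      have hspos : (0 : ℝ) < (seamCoreMultA Y E v S₁ S₂ b : ℝ) := by exact_mod_cast hs
      have hP : 0 < pooledDef Y b := lt_of_lt_of_le (mul_pos hp₀ hspos) hle
      simp only [hfS]
      rw [div_le_div_iff₀ hP hp₀, one_mul, mul_comm]
      exact hle
    calc ∑ b ∈ A, fS b = ∑ b ∈ A.filter (fun b => 0 < seamCoreMultA Y E v S₁ S₂ b), fS b :=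
          (sum_filter_of_ne fun b hb hne => Nat.pos_of_ne_zero fun h0 => hne ((key b hb).2 h0)).symm
      _ ≤ ∑ b ∈ A.filter (fun b => 0 < seamCoreMultA Y E v S₁ S₂ b), 1 / p₀ :=
          sum_le_sum fun b hb => ((key b (mem_filter.1 hb).1).1 (mem_filter.1 hb).2).2
      _ ≤ ∑ b ∈ AS, 1 / p₀ :=
          sum_le_sum_of_subset_of_nonneg (fun b hb => ((key b (mem_filter.1 hb).1).1 (mem_filter.1 hb).2).1) fun _ _ _ => by positivity
      _ = (AS.card : ℝ) / p₀ := by rw [sum_const, nsmul_eq_mul, mul_one_div]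
  linarith

end SplitAt

/-! ### The canonical core and the three named inputs -/

section Assembly

open scoped Classical in
/-- **THE CANONICAL COHERENT CORE** of the payer window for the placement `S`: the capping closure of the window balls at module sites. -/
def coreOf (X : Finset (EuclideanSpace ℝ (Fin 3))) (z : EuclideanSpace ℝ (Fin 3)) (S : EuclideanSpace ℝ (Fin 3) ≃ₗᵢ[ℝ] EuclideanSpace ℝ (Fin 3)) :
    Finset (EuclideanSpace ℝ (Fin 3)) :=
  capClosure (X.filter fun x => dist z x ≤ 3) (siteBallsAt S z (X.filter fun x => dist z x ≤ 3))

open scoped Classical in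
/-- The core lies in the window. -/
theorem coreOf_subset_window (X : Finset (EuclideanSpace ℝ (Fin 3))) (z : EuclideanSpace ℝ (Fin 3))
    (S : EuclideanSpace ℝ (Fin 3) ≃ₗᵢ[ℝ] EuclideanSpace ℝ (Fin 3)) : coreOf X z S ⊆ X.filter fun x => dist z x ≤ 3 :=
  capClosure_subset (siteBallsAt_subset _ _ _)

/-- The core lies in the configuration. -/
theorem coreOf_subset (X : Finset (EuclideanSpace ℝ (Fin 3))) (z : EuclideanSpace ℝ (Fin 3))
    (S : EuclideanSpace ℝ (Fin 3) ≃ₗᵢ[ℝ] EuclideanSpace ℝ (Fin 3)) : coreOf X z S ⊆ X :=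
  (coreOf_subset_window X z S).trans (filter_subset _ _)

open scoped Classical in
/-- The payer is a site ball (site `0`), hence in the core. -/
theorem mem_coreOf_self {X : Finset (EuclideanSpace ℝ (Fin 3))} {z : EuclideanSpace ℝ (Fin 3)} (hz : z ∈ X)
    (S : EuclideanSpace ℝ (Fin 3) ≃ₗᵢ[ℝ] EuclideanSpace ℝ (Fin 3)) : z ∈ coreOf X z S := by
  refine subset_capClosure _ (mem_filter.2 ⟨mem_filter.2 ⟨hz, by simp⟩, ?_⟩)
  refine ⟨(0, 0, 0), ?_, ?_⟩
  · simp [siteBall, dsq12]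
  · simp [modSite]

open scoped Classical in
/-- **The core is coherent as a configuration** (its own window about `z` is itself, enumerated by the stages of the closure). -/
theorem coherentAt_coreOf {X : Finset (EuclideanSpace ℝ (Fin 3))} {z : EuclideanSpace ℝ (Fin 3)}
    (S : EuclideanSpace ℝ (Fin 3) ≃ₗᵢ[ℝ] EuclideanSpace ℝ (Fin 3)) : CoherentAt (coreOf X z S) z := by
  obtain ⟨l, hl, hmem⟩ := exists_chain_of_capIter (W := X.filter fun x => dist z x ≤ 3)
    (sites := siteBallsAt S z (X.filter fun x => dist z x ≤ 3)) (D₀ := siteBallsAt S z (X.filter fun x => dist z x ≤ 3)) Subset.rfl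
    ((X.filter fun x => dist z x ≤ 3).card + 1)
  refine ⟨S, l, fun x => ?_, fun i => ?_⟩
  · rw [hmem]
    change x ∈ coreOf X z S ↔ _
    constructor
    · intro hx
      exact ⟨hx, (mem_filter.1 (coreOf_subset_window X z S hx)).2⟩
    · exact fun h => h.1
  · rcases hl i with hs | hc
    · exact Or.inl (mem_filter.1 hs).2
    · exact Or.inr hc

variable (cap : Finset (EuclideanSpace ℝ (Fin 3)) → EuclideanSpace ℝ (Fin 3) → ℕ)

open scoped Classical in
/-- The LOWERED pool of the core ball `b`: core pool minus the healing capacities of the core balls within `1` of `b`. -/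
def capPool (D : Finset (EuclideanSpace ℝ (Fin 3))) (b : EuclideanSpace ℝ (Fin 3)) : ℝ :=
  pooledDef D b - ∑ y ∈ D.filter (fun y => dist b y ≤ 1), (cap D y : ℝ)

open scoped Classical in
/-- The LOWERED joint (A)-summand of a core `D` at the payer `z` for the systems `(S₁, S₂)`. -/
def capSummand (v : WordVersion) (S₁ S₂ : PlateSystem) (D : Finset (EuclideanSpace ℝ (Fin 3))) (z : EuclideanSpace ℝ (Fin 3)) : ℝ :=
  ∑ b ∈ D.filter (fun b => dist z b ≤ 1 ∧ 0 < endMultA D v S₁ S₂ b), (endMultA D v S₁ S₂ b : ℝ) / capPool cap D b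

open scoped Classical in
/-- **EROSION-LOWERED COHERENT CERTIFICATE (named input; cf-p2 queue-4, lowered objective)**: every `1`-separated configuration that is COHERENT at a payer
`z` of degree `≤ 11` has positive lowered pools at its loaded balls within `1` of `z` and lowered joint summand `≤ s₁`, for every frame `L`. -/
def CoherentCoreCap (s₁ : ℝ) : Prop :=
  ∀ L : EuclideanSpace ℝ (Fin 3) ≃ₗᵢ[ℝ] EuclideanSpace ℝ (Fin 3),
  ∀ D : Finset (EuclideanSpace ℝ (Fin 3)), (∀ p ∈ D, ∀ q ∈ D, p ≠ q → 1 ≤ dist p q) →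
  ∀ z ∈ D, (D.filter fun q => dist z q = 1).card ≤ 11 → CoherentAt D z →
    (∀ b ∈ D, dist z b ≤ 1 →
      0 < endMultA D WordVersion.v2 (basalSystem L) (basalSystem (((ℝ ∙ EuclideanSpace.single (2 : Fin 3) (1 : ℝ)).reflection).trans L)) b →
      0 < capPool cap D b) ∧
    capSummand cap WordVersion.v2 (basalSystem L) (basalSystem (((ℝ ∙ EuclideanSpace.single (2 : Fin 3) (1 : ℝ)).reflection).trans L)) D z ≤ s₁

open scoped Classical in
/-- **JUNK CAP BOUND (named input; analytic, the cap table)**: a ball of the configuration outside the canonical core touches a core ball `y` within `2` of the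
payer only within the healing capacity `cap (core) y`. -/
def JunkCapBound : Prop :=
  ∀ X : Finset (EuclideanSpace ℝ (Fin 3)), (∀ p ∈ X, ∀ q ∈ X, p ≠ q → 1 ≤ dist p q) →
  ∀ z ∈ X, ∀ S : EuclideanSpace ℝ (Fin 3) ≃ₗᵢ[ℝ] EuclideanSpace ℝ (Fin 3),
  ∀ y ∈ coreOf X z S, dist z y ≤ 2 → ((X \ coreOf X z S).filter fun x => dist y x = 1).card ≤ cap (coreOf X z S) y

open scoped Classical in
/-- **SEAM SPARSITY (named input; analytic)**: at a residual NON-coherent payer window (`1`-separated, `deg z ≤ 11`, off-site, not mono-module for `L`,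
`k₀ < deg z`, not jammed-one), a deletion of inessential balls lands on-site or, for SOME placement `S`, at most `n₀` balls within `1` of the payer carry
seam pairs (pairs with a participant outside the canonical core) and each of them has `p₀ · seamCoreMultA ≤ pooledDef`. -/
def SeamSparsity (p₀ : ℝ) (n₀ k₀ : ℕ) : Prop :=
  ∀ L : EuclideanSpace ℝ (Fin 3) ≃ₗᵢ[ℝ] EuclideanSpace ℝ (Fin 3),
  ∀ X : Finset (EuclideanSpace ℝ (Fin 3)), (∀ p ∈ X, ∀ q ∈ X, p ≠ q → 1 ≤ dist p q) →
  ∀ z ∈ X, (X.filter fun q => dist z q = 1).card ≤ 11 → ¬ OnSiteAt coaxialModuleUniverse X z → ¬ MonoModuleAt L X z →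
    k₀ < (X.filter fun q => dist z q = 1).card → ¬ JammedOneAt X z → ¬ CoherentAt X z →
    HasDeletionOnSite X z ∨ ∃ S : EuclideanSpace ℝ (Fin 3) ≃ₗᵢ[ℝ] EuclideanSpace ℝ (Fin 3),
      (X.filter fun b => dist z b ≤ 1 ∧
        0 < seamCoreMultA X (coreOf X z S) WordVersion.v2 (basalSystem L)
          (basalSystem (((ℝ ∙ EuclideanSpace.single (2 : Fin 3) (1 : ℝ)).reflection).trans L)) b).card ≤ n₀ ∧
      ∀ b ∈ X, dist z b ≤ 1 →
        0 < seamCoreMultA X (coreOf X z S) WordVersion.v2 (basalSystem L)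
          (basalSystem (((ℝ ∙ EuclideanSpace.single (2 : Fin 3) (1 : ℝ)).reflection).trans L)) b →
        p₀ * (seamCoreMultA X (coreOf X z S) WordVersion.v2 (basalSystem L)
          (basalSystem (((ℝ ∙ EuclideanSpace.single (2 : Fin 3) (1 : ℝ)).reflection).trans L)) b : ℝ) ≤ pooledDef X b

/-! ### The assembly -/

open scoped Classical in
/-- The healing term of the comparison is bounded by the capacities (sum of the junk cap bound over the core balls within `1` of `b`). -/
theorem heal_le_capSum {X : Finset (EuclideanSpace ℝ (Fin 3))} (hX : ∀ p ∈ X, ∀ q ∈ X, p ≠ q → 1 ≤ dist p q) (hcap : JunkCapBound cap)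
    {z : EuclideanSpace ℝ (Fin 3)} (hz : z ∈ X) (S : EuclideanSpace ℝ (Fin 3) ≃ₗᵢ[ℝ] EuclideanSpace ℝ (Fin 3)) {b : EuclideanSpace ℝ (Fin 3)}
    (hzb : dist z b ≤ 1) :
    (((((coreOf X z S).filter fun y => dist b y ≤ 1) ×ˢ (X \ coreOf X z S)).filter fun p => dist p.1 p.2 = 1).card : ℝ) ≤
      ∑ y ∈ (coreOf X z S).filter (fun y => dist b y ≤ 1), (cap (coreOf X z S) y : ℝ) := by
  set D := coreOf X z S with hD
  have hsplit : (((D.filter fun y => dist b y ≤ 1) ×ˢ (X \ D)).filter fun p => dist p.1 p.2 = 1).card =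
      ∑ y ∈ D.filter (fun y => dist b y ≤ 1), ((X \ D).filter fun x => dist y x = 1).card := by
    rw [card_filter, sum_product]
    refine sum_congr rfl fun y _ => ?_
    rw [card_filter]
  push_cast [hsplit]
  refine sum_le_sum fun y hy => ?_
  obtain ⟨hyD, hby⟩ := mem_filter.1 hy
  have hzy : dist z y ≤ 2 := by linarith [dist_triangle z b y]
  exact_mod_cast hcap X hX z hz S y hyD hzy

open scoped Classical in
/-- **THE ASSEMBLY**: erosion-lowered coherent certificate + junk cap bound + seam sparsity ⇒ the Σ-form incoherent stub at the line `s ≥ s₁ + n₀/p₀`. -/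
theorem incoherentSeamSmall_of_assembly {s s₁ p₀ : ℝ} {n₀ k₀ : ℕ} (hcert : CoherentCoreCap cap s₁) (hcap : JunkCapBound cap)
    (hsp : SeamSparsity p₀ n₀ k₀) (hp₀ : 0 < p₀) (hs : s₁ + n₀ / p₀ ≤ s) : IncoherentSeamSmall s k₀ := by
  intro L X hX z hz hdeg hoff hM hk hJ hco
  rcases hsp L X hX z hz hdeg hoff hM hk hJ hco with hdel | ⟨S, hn, hratio⟩
  · exact Or.inl hdel
  right
  set S₁ := basalSystem L with hS₁
  set S₂ := basalSystem (((ℝ ∙ EuclideanSpace.single (2 : Fin 3) (1 : ℝ)).reflection).trans L) with hS₂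
  set D := coreOf X z S with hD
  have hDX : D ⊆ X := coreOf_subset X z S
  have hDsep : ∀ p ∈ D, ∀ q ∈ D, p ≠ q → 1 ≤ dist p q := fun p hp q hq => hX p (hDX hp) q (hDX hq)
  have hzD : z ∈ D := mem_coreOf_self hz S
  have hdegD : (D.filter fun q => dist z q = 1).card ≤ 11 :=
    (card_le_card (fun q hq => mem_filter.2 ⟨hDX (mem_filter.1 hq).1, (mem_filter.1 hq).2⟩)).trans hdeg
  obtain ⟨hpos, hsum⟩ := hcert L D hDsep z hzD hdegD (coherentAt_coreOf S)
  have h₁ : S₁.RT ⊆ fccSlots := filter_subset _ _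
  have h₂ : S₂.RT ⊆ fccSlots := filter_subset _ _
  -- positivity of the comparison's lowered pools at loaded core balls
  have hheal : ∀ b, dist z b ≤ 1 →
      ((((D.filter fun y => dist b y ≤ 1) ×ˢ (X \ D)).filter fun p => dist p.1 p.2 = 1).card : ℝ) ≤
        ∑ y ∈ D.filter (fun y => dist b y ≤ 1), (cap D y : ℝ) := fun b hzb => heal_le_capSum cap hX hcap hz S hzb
  have hdefnn : ∀ b, 0 ≤ ∑ x ∈ (X \ D).filter (fun x => dist b x ≤ 1 ∧ (X.filter fun q => dist x q = 1).card ≤ 11),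
      ((12 : ℝ) - ((X.filter fun q => dist x q = 1).card : ℝ)) := by
    intro b
    refine sum_nonneg fun x hx => ?_
    have h11 := (mem_filter.1 hx).2.2
    have : ((X.filter fun q => dist x q = 1).card : ℝ) ≤ 11 := by exact_mod_cast h11
    linarith
  have hcmp : ∀ b, dist z b ≤ 1 → capPool cap D b ≤
      pooledDef D b - ((((D.filter fun y => dist b y ≤ 1) ×ˢ (X \ D)).filter fun p => dist p.1 p.2 = 1).card : ℝ) +
        ∑ x ∈ (X \ D).filter (fun x => dist b x ≤ 1 ∧ (X.filter fun q => dist x q = 1).card ≤ 11),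
          ((12 : ℝ) - ((X.filter fun q => dist x q = 1).card : ℝ)) := by
    intro b hzb
    have h1 := hheal b hzb
    have h2 := hdefnn b
    simp only [capPool]
    linarith
  have hposE : ∀ b ∈ D, dist z b ≤ 1 → 0 < endMultA D WordVersion.v2 S₁ S₂ b →
      0 < pooledDef D b - ((((D.filter fun y => dist b y ≤ 1) ×ˢ (X \ D)).filter fun p => dist p.1 p.2 = 1).card : ℝ) +
        ∑ x ∈ (X \ D).filter (fun x => dist b x ≤ 1 ∧ (X.filter fun q => dist x q = 1).card ≤ 11),
          ((12 : ℝ) - ((X.filter fun q => dist x q = 1).card : ℝ)) :=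
    fun b hb hzb he => lt_of_lt_of_le (hpos b hb hzb he) (hcmp b hzb)
  have hsplit := localSummandA_le_core_add_seam_at (Y := X) (E := D) (v := WordVersion.v2) (S₁ := S₁) (S₂ := S₂) hX hDX h₁ h₂ z hp₀ hposE
    (fun b hb hzb hs' => hratio b hb hzb hs')
  -- core term ≤ lowered certificate value
  have hcore : (∑ b ∈ D.filter (fun b => dist z b ≤ 1 ∧ 0 < endMultA D WordVersion.v2 S₁ S₂ b),
      (endMultA D WordVersion.v2 S₁ S₂ b : ℝ) /
        (pooledDef D b - ((((D.filter fun y => dist b y ≤ 1) ×ˢ (X \ D)).filter fun p => dist p.1 p.2 = 1).card : ℝ) +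
          ∑ x ∈ (X \ D).filter (fun x => dist b x ≤ 1 ∧ (X.filter fun q => dist x q = 1).card ≤ 11),
            ((12 : ℝ) - ((X.filter fun q => dist x q = 1).card : ℝ)))) ≤ capSummand cap WordVersion.v2 S₁ S₂ D z := by
    unfold capSummand
    refine sum_le_sum fun b hb => ?_
    obtain ⟨hbD, hzb, he⟩ := mem_filter.1 hb
    exact div_le_div_of_nonneg_left (Nat.cast_nonneg _) (hpos b hbD hzb he) (hcmp b hzb)
  -- seam term ≤ n₀ / p₀
  have hseam : (((X.filter fun b => dist z b ≤ 1 ∧ 0 < seamCoreMultA X D WordVersion.v2 S₁ S₂ b).card : ℝ)) / p₀ ≤ (n₀ : ℝ) / p₀ := by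
    have : ((X.filter fun b => dist z b ≤ 1 ∧ 0 < seamCoreMultA X D WordVersion.v2 S₁ S₂ b).card : ℝ) ≤ n₀ := by exact_mod_cast hn
    exact div_le_div_of_nonneg_right this hp₀.le
  linarith

end Assembly

end TailResidue

end Summit.Ventures.Crystal3D.Theorems

end
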